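import Summits.QuantumFields.GaugeBoot.BootstrapFunctionals
import Summits.QuantumFields.GaugeBoot.BootstrapBounds
import HarnessLib

/-!
# Convergence of the truncated lattice bootstrap in finite volume (gauge-boot, L1 supplement)

HONEST FRAMING (cell `pub-gaugeboot`, page 1 of every file): the venture produces certified bounds
on lattice expectations at stated coupling, gauge group, dimension and torus size; NOT a mass gap,
NOT a continuum limit, NOT a string tension; NOT Yang–Mills-summit-bearing (barriers
`FixedCouplingUltralocality`, `PerturbativeInvisibility`). Structural; it certifies no number
and says nothing about RATES of convergence.

## Content

A TRUNCATED bootstrap keeps, of the untruncated constraints (N) `φ 1 = 1`, (P) `0 ≤ φ (v v)`,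
(SD) `φ f' = β φ (f S_i')`, only those whose test functions `v`, `f` lie in a set `V`
(`IsBootstrapFeasible … V φ`; `V` = all polynomials is the untruncated bootstrap of
`BootstrapFunctionals.lean`, `isBootstrapFeasible_poly_iff`). A truncation SCHEME is any sequence
`V n` which eventually contains every polynomial observable (e.g. words of length `≤ n`).

* ★★★ `bootstrap_convergence` — for every polynomial observable `P` and `ε > 0` there is a level
  `n` such that EVERY level-`n` feasible value `φ P` is within `ε` of the value `ψ P` of some
  solution `ψ` of the untruncated bootstrap. No uniqueness is presupposed: compactness
  (`BootstrapBounds.exists_finset_abs_le` + Tychonoff, a cluster point of putative solutions in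
  the product topology) and closedness of every single constraint.
* ★★★ `bootstrap_convergence_suN` / `_uN` — `SU(N)` / `U(N)` on the torus `(ℤ/L)^d`, ANY real
  `β`, any truncation scheme: the level-`n` feasible values of `P` all lie within `ε` of the Wilson
  expectation `∫ P dμ_Wilson` for `n` large (uniqueness from `eq_wilson_of_bootstrap_suN`); since
  the Wilson expectation is feasible at every level (`isBootstrapFeasible_expectationFunctional`), the SDP
  upper and lower bounds at level `n` CONVERGE to the Wilson value.
* `bootstrap_convergence_dlr_suN` — `ℤ^d`: level-`n` values are eventually within `ε` of
  `{∫ P dμ : μ DLR}`.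

References: P. Anderson, M. Kruczenski, Nucl. Phys. B 921 (2017); V. Kazakov, Z. Zheng,
arXiv:2203.11360 (convergence observed numerically, their Fig. 3 ff.); Z. Li, S. Zhou,
arXiv:2404.17071; J. B. Lasserre, SIAM J. Optim. 11 (2001) (the analogous convergence of moment
relaxations in polynomial optimisation, via Putinar — not used here). Folklore.
-/

noncomputable section

open MeasureTheory Filter Topology NormedSpace
open Literature.MathematicalPhysics.QuantumFieldTheory (haarProbability LatticeRep)

namespace Summit.QuantumFields.GaugeBoot

section General

variable {ι : Type*} [DecidableEq ι] [Countable ι] {G : Type*} [Group G] [TopologicalSpace G]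
  [IsTopologicalGroup G] [CompactSpace G] [MeasurableSpace G] [BorelSpace G]
  [SecondCountableTopology G] (r : LatticeRep G) {K : Type*}

/-- **Truncated bootstrap feasibility.** `φ` (a linear assignment of values to observables) is
feasible for the bootstrap with TEST-FUNCTION SET `V`: normalised, non-negative on the squares of
the elements of `V`, and satisfying the Schwinger–Dyson identities `φ f' = β φ (f S_i')` for the
test functions `f ∈ V` (with `S_i'`, `f'` the polynomial derivatives along the one-link shifts).
`V` = all polynomial observables is the untruncated bootstrap. [shape] A parametric definition of
a proposition — NOT a fact. [folklore] -/
def IsBootstrapFeasible (k : K → ℝ → G) (S : ι → (ι → G) → ℝ) (β : ℝ) (V : Set C(ι → G, ℝ))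
    (φ : C(ι → G, ℝ) →ₗ[ℝ] ℝ) : Prop :=
  φ 1 = 1 ∧ (∀ v ∈ V, 0 ≤ φ (v * v)) ∧
    ∀ (i : ι) (a : K), ∃ S' ∈ polyAlgebra (ι := ι) r,
      (∀ U, HasDerivAt (fun t => S i (Function.update U i (k a t * U i))) (S' U) 0) ∧
        ∀ f ∈ V, ∀ f' ∈ polyAlgebra (ι := ι) r,
          (∀ U, HasDerivAt (fun t => f (Function.update U i (k a t * U i))) (f' U) 0) →
            φ f' = β * φ (f * S')

variable {k : K → ℝ → G} {X : K → Matrix (Fin r.N) (Fin r.N) ℂ} {S : ι → (ι → G) → ℝ} {β : ℝ}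

omit [Countable ι] [IsTopologicalGroup G] [CompactSpace G] [MeasurableSpace G] [BorelSpace G]
  [SecondCountableTopology G] in
/-- **The untruncated bootstrap** (`V` = all polynomials) is exactly (N)+(P)+(SD) of
`BootstrapFunctionals.lean`. -/
theorem isBootstrapFeasible_poly_iff {φ : C(ι → G, ℝ) →ₗ[ℝ] ℝ} :
    IsBootstrapFeasible r k S β (polyAlgebra (ι := ι) r : Set C(ι → G, ℝ)) φ ↔
      φ 1 = 1 ∧ (∀ a ∈ polyAlgebra (ι := ι) r, 0 ≤ φ (a * a)) ∧ IsSDFunctional r k S β φ :=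
  Iff.rfl

omit [Countable ι] [IsTopologicalGroup G] [CompactSpace G] [MeasurableSpace G] [BorelSpace G]
  [SecondCountableTopology G] in
/-- **Feasibility is antitone in the test-function set**: more test functions, fewer feasible
functionals. -/
theorem IsBootstrapFeasible.mono {V W : Set C(ι → G, ℝ)} (hVW : V ⊆ W) {φ : C(ι → G, ℝ) →ₗ[ℝ] ℝ}
    (h : IsBootstrapFeasible r k S β W φ) : IsBootstrapFeasible r k S β V φ := by
  refine ⟨h.1, fun v hv => h.2.1 v (hVW hv), fun i a => ?_⟩
  obtain ⟨S', hS'm, hS', hrows⟩ := h.2.2 i a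
  exact ⟨S', hS'm, hS', fun f hf => hrows f (hVW hf)⟩

/-- **The expectation functional of a polynomial Schwinger–Dyson probability state is feasible at
every level** with polynomial test functions (so every truncation's feasible set contains the true
expectation values). -/
theorem isBootstrapFeasible_expectationFunctional (hk : ∀ a s t, k a (s + t) = k a s * k a t)
    (hX : ∀ a t, r.ρ (k a t) = exp ((t : ℂ) • X a)) (hS : ∀ i, S i ∈ polyFunctions (ι := ι) r)
    (μ : Measure (ι → G)) [IsProbabilityMeasure μ] (hμ : IsPolySchwingerDysonState r k S β μ)
    {V : Set C(ι → G, ℝ)} (hV : V ⊆ polyAlgebra (ι := ι) r) :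
    IsBootstrapFeasible r k S β V (expectationFunctional μ) :=
  ((isBootstrapFeasible_poly_iff r).2
    ⟨expectationFunctional_one μ, fun v _ => expectationFunctional_sq_nonneg μ v,
      isSDFunctional_expectationFunctional r hk hX hS μ hμ⟩).mono r hV

/-- A cluster point of a sequence lies in every closed set the sequence is eventually in. -/
theorem mem_of_clusterPt_map {Y : Type*} [TopologicalSpace Y] {u : ℕ → Y} {x : Y}
    (hx : ClusterPt x (map u atTop)) {T : Set Y} (hT : IsClosed T) (hu : ∀ᶠ n in atTop, u n ∈ T) :
    x ∈ T :=
  (isClosed_iff_clusterPt.1 hT) x (hx.mono (le_principal_iff.2 (mem_map.2 hu)))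

omit [Countable ι] [CompactSpace G] [MeasurableSpace G] [BorelSpace G] [SecondCountableTopology G] in
/-- ★★★ **Convergence of the truncated bootstrap.** Exponential family `ρ(k_a t) = e^{tX_a}`,
polynomial local actions, ANY truncation scheme `V n` eventually containing each polynomial
observable. For every polynomial observable `P` and `ε > 0` there is a level `n` such that every
level-`n` feasible value `φ P` lies within `ε` of the value `ψ P` of a solution `ψ` of the
UNTRUNCATED bootstrap. (Compactness: finitely many PSD constraints bound each coordinate,
`exists_finset_abs_le`; a cluster point of level-`n` solutions in the product topology solves every
constraint, each being closed and eventually imposed.) [folklore] -/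
theorem bootstrap_convergence (hk : ∀ a s t, k a (s + t) = k a s * k a t)
    (hX : ∀ a t, r.ρ (k a t) = exp ((t : ℂ) • X a)) (hS : ∀ i, S i ∈ polyFunctions (ι := ι) r)
    (V : ℕ → Set C(ι → G, ℝ)) (hex : ∀ a ∈ polyAlgebra (ι := ι) r, ∀ᶠ n in atTop, a ∈ V n)
    {P : C(ι → G, ℝ)} (hP : P ∈ polyAlgebra (ι := ι) r) {ε : ℝ} (hε : 0 < ε) :
    ∃ n, ∀ φ : C(ι → G, ℝ) →ₗ[ℝ] ℝ, IsBootstrapFeasible r k S β (V n) φ →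
      ∃ ψ : C(ι → G, ℝ) →ₗ[ℝ] ℝ,
        IsBootstrapFeasible r k S β (polyAlgebra (ι := ι) r : Set C(ι → G, ℝ)) ψ ∧ |φ P - ψ P| ≤ ε := by
  classical
  by_contra hcon
  push Not at hcon
  choose φ hφ hfar using hcon
  -- the polynomial derivatives of the local actions
  have hS'ex : ∀ (i : ι) (a : K), ∃ S' ∈ polyAlgebra (ι := ι) r,
      ∀ U, HasDerivAt (fun t => S i (Function.update U i (k a t * U i))) (S' U) 0 := fun i a => by
    obtain ⟨S₀, hS₀, hS₀e⟩ := (mem_polyFunctions_iff r).1 (hS i)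
    obtain ⟨S', hS'm, hS'⟩ := exists_deriv_mem_polyAlgebra r (hk a) (hX a) i hS₀
    exact ⟨S', hS'm, by rw [← hS₀e]; exact hS'⟩
  choose S' hS'm hS'd using hS'ex
  -- archimedean bounds: each polynomial is bounded by finitely many PSD constraints
  have hb : ∀ a : C(ι → G, ℝ), ∃ (C : ℝ) (s : Finset C(ι → G, ℝ)), a ∈ polyAlgebra (ι := ι) r →
      (∀ v ∈ s, v ∈ polyAlgebra (ι := ι) r) ∧ ∀ φ : C(ι → G, ℝ) →ₗ[ℝ] ℝ, φ 1 = 1 →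
        (∀ v ∈ s, 0 ≤ φ (v * v)) → |φ a| ≤ C := fun a => by
    by_cases ha : a ∈ polyAlgebra (ι := ι) r
    · obtain ⟨C, s, h1, h2⟩ := exists_finset_abs_le r ha
      exact ⟨C, s, fun _ => ⟨h1, h2⟩⟩
    · exact ⟨0, ∅, fun h => (ha h).elim⟩
  choose C s hCs using hb
  -- the truncated sequence of putative solutions, as points of the product space
  let good : ℕ → C(ι → G, ℝ) → Prop := fun n a => a ∈ polyAlgebra (ι := ι) r ∧ ∀ v ∈ s a, v ∈ V n
  let Φ : ℕ → (C(ι → G, ℝ) → ℝ) := fun n a => if good n a then φ n a else 0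
  have hgood : ∀ a ∈ polyAlgebra (ι := ι) r, ∀ᶠ n in atTop, good n a := fun a ha => by
    have h : ∀ᶠ n in atTop, ∀ v ∈ s a, v ∈ V n :=
      (Filter.eventually_all_finset (s a)).2 fun v hv => hex v ((hCs a ha).1 v hv)
    exact h.mono fun n hn => ⟨ha, hn⟩
  have hΦeq : ∀ a ∈ polyAlgebra (ι := ι) r, ∀ᶠ n in atTop, Φ n a = φ n a := fun a ha =>
    (hgood a ha).mono fun n hn => if_pos hn
  -- it lives in a compact box (Tychonoff)
  set B : Set (C(ι → G, ℝ) → ℝ) := Set.univ.pi fun a => Set.Icc (-|C a|) |C a| with hB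
  have hBc : IsCompact B := isCompact_univ_pi fun a => isCompact_Icc
  have hΦB : ∀ n, Φ n ∈ B := fun n => Set.mem_univ_pi.2 fun a => by
    by_cases hg : good n a
    · have h := (hCs a hg.1).2 (φ n) (hφ n).1 fun v hv => (hφ n).2.1 v (hg.2 v hv)
      have h' : |Φ n a| ≤ |C a| := by
        simp only [Φ, if_pos hg]
        exact h.trans (le_abs_self _)
      exact ⟨(abs_le.1 h').1, (abs_le.1 h').2⟩
    · simp only [Φ, if_neg hg, Set.mem_Icc, Left.neg_nonpos_iff, abs_nonneg, and_self]
  -- a cluster point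
  obtain ⟨x, -, hx⟩ := hBc.exists_clusterPt (f := map Φ atTop)
    (le_principal_iff.2 (mem_map.2 (Eventually.of_forall hΦB)))
  have key : ∀ {T : Set (C(ι → G, ℝ) → ℝ)}, IsClosed T → (∀ᶠ n in atTop, Φ n ∈ T) → x ∈ T :=
    fun hT hev => mem_of_clusterPt_map hx hT hev
  -- the cluster point solves every untruncated constraint
  have hx1 : x 1 = 1 := by
    refine key (T := {y | y 1 = 1}) (isClosed_eq (continuous_apply _) continuous_const) ?_
    filter_upwards [hΦeq 1 (polyAlgebra (ι := ι) r).one_mem] with n h1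
    simp only [h1]
    exact (hφ n).1
  have hxadd : ∀ a ∈ polyAlgebra (ι := ι) r, ∀ b ∈ polyAlgebra (ι := ι) r,
      x (a + b) = x a + x b := fun a ha b hb => by
    refine key (T := {y | y (a + b) = y a + y b})
      (isClosed_eq (continuous_apply _) ((continuous_apply a).add (continuous_apply b))) ?_
    filter_upwards [hΦeq a ha, hΦeq b hb, hΦeq (a + b) ((polyAlgebra (ι := ι) r).add_mem ha hb)]
      with n h1 h2 h3
    simp only [h1, h2, h3, map_add]
  have hxsmul : ∀ (c : ℝ), ∀ a ∈ polyAlgebra (ι := ι) r, x (c • a) = c * x a := fun c a ha => by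
    refine key (T := {y | y (c • a) = c * y a})
      (isClosed_eq (continuous_apply _) (continuous_const.mul (continuous_apply a))) ?_
    filter_upwards [hΦeq a ha, hΦeq (c • a) ((polyAlgebra (ι := ι) r).smul_mem ha c)] with n h1 h2
    simp only [h1, h2, map_smul, smul_eq_mul]
  have hxpos : ∀ v ∈ polyAlgebra (ι := ι) r, 0 ≤ x (v * v) := fun v hv => by
    refine key (T := {y | 0 ≤ y (v * v)}) (isClosed_le continuous_const (continuous_apply _)) ?_
    filter_upwards [hΦeq (v * v) ((polyAlgebra (ι := ι) r).mul_mem hv hv), hex v hv] with n h1 h2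
    simp only [h1]
    exact (hφ n).2.1 v h2
  have hxsd : ∀ (i : ι) (a : K), ∀ f ∈ polyAlgebra (ι := ι) r, ∀ f' ∈ polyAlgebra (ι := ι) r,
      (∀ U, HasDerivAt (fun t => f (Function.update U i (k a t * U i))) (f' U) 0) →
        x f' = β * x (f * S' i a) := fun i a f hf f' hf' hd => by
    refine key (T := {y | y f' = β * y (f * S' i a)})
      (isClosed_eq (continuous_apply _) (continuous_const.mul (continuous_apply _))) ?_
    filter_upwards [hΦeq f' hf', hΦeq (f * S' i a) ((polyAlgebra (ι := ι) r).mul_mem hf (hS'm i a)),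
      hex f hf] with n h1 h2 h3
    simp only [h1, h2]
    obtain ⟨S'', -, hS''d, hrows⟩ := (hφ n).2.2 i a
    have he : S'' = S' i a := ContinuousMap.ext fun U => (hS''d U).unique (hS'd i a U)
    rw [← he]
    exact hrows f h3 f' hf' hd
  have hxfar : ∀ ψ : C(ι → G, ℝ) →ₗ[ℝ] ℝ,
      IsBootstrapFeasible r k S β (polyAlgebra (ι := ι) r : Set C(ι → G, ℝ)) ψ → ε ≤ |x P - ψ P| :=
    fun ψ hψ => by
    refine key (T := {y | ε ≤ |y P - ψ P|})
      (isClosed_le continuous_const ((continuous_apply P).sub continuous_const).abs) ?_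
    filter_upwards [hΦeq P hP] with n h1
    simp only [h1]
    exact (hfar n ψ hψ).le
  -- the cluster point IS an untruncated solution: contradiction
  let ψ₀ : Subalgebra.toSubmodule (polyAlgebra (ι := ι) r) →ₗ[ℝ] ℝ :=
    { toFun := fun a => x a
      map_add' := fun a b => hxadd a a.2 b b.2
      map_smul' := fun c a => by simpa using hxsmul c a a.2 }
  obtain ⟨ψ, hψ⟩ := LinearMap.exists_extend ψ₀
  have hψa : ∀ a ∈ polyAlgebra (ι := ι) r, ψ a = x a := fun a ha => by
    have h := LinearMap.congr_fun hψ ⟨a, ha⟩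
    simpa [ψ₀] using h
  have hψfeas : IsBootstrapFeasible r k S β (polyAlgebra (ι := ι) r : Set C(ι → G, ℝ)) ψ := by
    refine ⟨by rw [hψa 1 (polyAlgebra (ι := ι) r).one_mem, hx1], fun v hv => ?_, fun i a => ?_⟩
    · rw [hψa _ ((polyAlgebra (ι := ι) r).mul_mem hv hv)]
      exact hxpos v hv
    · refine ⟨S' i a, hS'm i a, hS'd i a, fun f hf f' hf' hd => ?_⟩
      rw [hψa f' hf', hψa _ ((polyAlgebra (ι := ι) r).mul_mem hf (hS'm i a))]
      exact hxsd i a f hf f' hf' hd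
  have h := hxfar ψ hψfeas
  rw [hψa P hP, sub_self, abs_zero] at h
  exact absurd h (not_le.2 hε)

omit [Countable ι] [CompactSpace G] [MeasurableSpace G] [BorelSpace G] [SecondCountableTopology G] in
/-- ★★★ **Convergence when the untruncated bootstrap determines `P`**: if every untruncated
solution gives `P` the value `w`, the level-`n` feasible values of `P` are all within `ε` of `w`
for some `n`. [folklore] -/
theorem bootstrap_convergence_of_unique (hk : ∀ a s t, k a (s + t) = k a s * k a t)
    (hX : ∀ a t, r.ρ (k a t) = exp ((t : ℂ) • X a)) (hS : ∀ i, S i ∈ polyFunctions (ι := ι) r)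
    (V : ℕ → Set C(ι → G, ℝ)) (hex : ∀ a ∈ polyAlgebra (ι := ι) r, ∀ᶠ n in atTop, a ∈ V n)
    {P : C(ι → G, ℝ)} (hP : P ∈ polyAlgebra (ι := ι) r) {w : ℝ}
    (hw : ∀ ψ : C(ι → G, ℝ) →ₗ[ℝ] ℝ,
      IsBootstrapFeasible r k S β (polyAlgebra (ι := ι) r : Set C(ι → G, ℝ)) ψ → ψ P = w)
    {ε : ℝ} (hε : 0 < ε) :
    ∃ n, ∀ φ : C(ι → G, ℝ) →ₗ[ℝ] ℝ, IsBootstrapFeasible r k S β (V n) φ → |φ P - w| ≤ ε := by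
  obtain ⟨n, hn⟩ := bootstrap_convergence r hk hX hS V hex hP hε
  refine ⟨n, fun φ hφ => ?_⟩
  obtain ⟨ψ, hψ, hclose⟩ := hn φ hφ
  rwa [hw ψ hψ] at hclose

omit [Countable ι] [CompactSpace G] [MeasurableSpace G] [BorelSpace G] [SecondCountableTopology G] in
/-- **Monotone schemes**: for an increasing truncation scheme the conclusion holds at every level
`m ≥ n`. [folklore] -/
theorem bootstrap_convergence_of_unique_mono (hk : ∀ a s t, k a (s + t) = k a s * k a t)
    (hX : ∀ a t, r.ρ (k a t) = exp ((t : ℂ) • X a)) (hS : ∀ i, S i ∈ polyFunctions (ι := ι) r)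
    (V : ℕ → Set C(ι → G, ℝ)) (hmono : Monotone V)
    (hex : ∀ a ∈ polyAlgebra (ι := ι) r, ∀ᶠ n in atTop, a ∈ V n)
    {P : C(ι → G, ℝ)} (hP : P ∈ polyAlgebra (ι := ι) r) {w : ℝ}
    (hw : ∀ ψ : C(ι → G, ℝ) →ₗ[ℝ] ℝ,
      IsBootstrapFeasible r k S β (polyAlgebra (ι := ι) r : Set C(ι → G, ℝ)) ψ → ψ P = w)
    {ε : ℝ} (hε : 0 < ε) :
    ∀ᶠ m in atTop, ∀ φ : C(ι → G, ℝ) →ₗ[ℝ] ℝ, IsBootstrapFeasible r k S β (V m) φ → |φ P - w| ≤ ε := by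
  obtain ⟨n, hn⟩ := bootstrap_convergence_of_unique r hk hX hS V hex hP hw hε
  exact eventually_atTop.2 ⟨n, fun m hm φ hφ => hn φ (hφ.mono r (hmono hm))⟩

end General

/-! ## `SU(N)` and `U(N)` on the torus; `ℤ^d` -/

section Unitary

open Literature.MathematicalPhysics.QuantumFieldTheory (Edge GaugeConfig wilsonAction wilsonMeasure)
open Literature.MathematicalPhysics.QuantumLattice

variable {d L : ℕ}

/-- ★★★ **Convergence of the `SU(N)` lattice bootstrap in finite volume.** On the torus
`(ℤ/L)^d`, ANY real `β`, any truncation scheme `V n` eventually containing each polynomial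
observable: for every polynomial observable `P` and `ε > 0` there is a level `n` at which EVERY
feasible value of `P` (normalisation + PSD of the squares of `V n` + loop equations with test
functions in `V n`) is within `ε` of the Wilson expectation `∫ P dμ_Wilson`. [folklore] -/
theorem bootstrap_convergence_suN [NeZero L] (N : ℕ) (β : ℝ)
    (V : ℕ → Set C(GaugeConfig d L (Matrix.specialUnitaryGroup (Fin N) ℂ), ℝ))
    (hex : ∀ a ∈ polyAlgebra (ι := Edge d L) (fundamentalLatticeRep N), ∀ᶠ n in atTop, a ∈ V n)
    {P : C(GaugeConfig d L (Matrix.specialUnitaryGroup (Fin N) ℂ), ℝ)}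
    (hP : P ∈ polyAlgebra (ι := Edge d L) (fundamentalLatticeRep N)) {ε : ℝ} (hε : 0 < ε) :
    ∃ n, ∀ φ : C(GaugeConfig d L (Matrix.specialUnitaryGroup (Fin N) ℂ), ℝ) →ₗ[ℝ] ℝ,
      IsBootstrapFeasible (fundamentalLatticeRep N) (suExp N)
          (fun _ => wilsonAction (fundamentalRep (Fin N))) β (V n) φ →
        |φ P - ∫ U, P U ∂(wilsonMeasure (fundamentalRep (Fin N)) β)| ≤ ε :=
  bootstrap_convergence_of_unique (fundamentalLatticeRep N) (suExp_add N)
    (X := fun X : SuGenerator N => (X : Matrix (Fin N) (Fin N) ℂ)) (rho_suExp N)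
    (fun _ => wilsonAction_mem_polyFunctions (fundamentalLatticeRep N)) V hex hP
    (fun _ hψ => eq_wilson_of_bootstrap_suN N β hψ.1 hψ.2.1 hψ.2.2 hP) hε

/-- ★★★ **Convergence of the `U(N)` lattice bootstrap in finite volume** (shifts `e^{tX}`,
`X ∈ 𝔲(N)`). [folklore] -/
theorem bootstrap_convergence_uN [NeZero L] (N : ℕ) (β : ℝ)
    (V : ℕ → Set C(GaugeConfig d L (Matrix.unitaryGroup (Fin N) ℂ), ℝ))
    (hex : ∀ a ∈ polyAlgebra (ι := Edge d L) (unitaryFundamentalLatticeRep N), ∀ᶠ n in atTop, a ∈ V n)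
    {P : C(GaugeConfig d L (Matrix.unitaryGroup (Fin N) ℂ), ℝ)}
    (hP : P ∈ polyAlgebra (ι := Edge d L) (unitaryFundamentalLatticeRep N)) {ε : ℝ} (hε : 0 < ε) :
    ∃ n, ∀ φ : C(GaugeConfig d L (Matrix.unitaryGroup (Fin N) ℂ), ℝ) →ₗ[ℝ] ℝ,
      IsBootstrapFeasible (unitaryFundamentalLatticeRep N) (uExp N)
          (fun _ => wilsonAction (unitaryFundamentalRep (Fin N) ℂ)) β (V n) φ →
        |φ P - ∫ U, P U ∂(wilsonMeasure (unitaryFundamentalRep (Fin N) ℂ) β)| ≤ ε :=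
  bootstrap_convergence_of_unique (unitaryFundamentalLatticeRep N) (uExp_add N)
    (X := fun X : UGenerator N => (X : Matrix (Fin N) (Fin N) ℂ)) (rho_uExp N)
    (fun _ => wilsonAction_mem_polyFunctions (unitaryFundamentalLatticeRep N)) V hex hP
    (fun _ hψ => eq_wilson_of_bootstrap_uN N β hψ.1 hψ.2.1 hψ.2.2 hP) hε

/-- **The Wilson expectation is feasible at every (polynomial) level** (`SU(N)`, torus): the
truncated feasible sets are non-empty and contain the true value, so `bootstrap_convergence_suN`
says the level-`n` SDP bounds `min/max {φ P}` converge to `∫ P dμ_Wilson`. [folklore] -/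
theorem isBootstrapFeasible_wilson_suN [NeZero L] (N : ℕ) (β : ℝ)
    (μ : Measure (GaugeConfig d L (Matrix.specialUnitaryGroup (Fin N) ℂ))) [IsProbabilityMeasure μ]
    (hμ : μ = wilsonMeasure (fundamentalRep (Fin N)) β)
    {V : Set C(GaugeConfig d L (Matrix.specialUnitaryGroup (Fin N) ℂ), ℝ)}
    (hV : V ⊆ polyAlgebra (ι := Edge d L) (fundamentalLatticeRep N)) :
    IsBootstrapFeasible (fundamentalLatticeRep N) (suExp N)
      (fun _ => wilsonAction (fundamentalRep (Fin N))) β V (expectationFunctional μ) :=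
  isBootstrapFeasible_expectationFunctional (fundamentalLatticeRep N) (suExp_add N)
    (X := fun X : SuGenerator N => (X : Matrix (Fin N) (Fin N) ℂ)) (rho_suExp N)
    (fun _ => wilsonAction_mem_polyFunctions (fundamentalLatticeRep N)) μ
    ((eq_wilsonMeasure_iff_polySD_suN N β μ).1 hμ) hV

/-- ★★ **`SU(N)` on `ℤ^d`**: level-`n` feasible values of `P` are eventually within `ε` of the
expectation of `P` in some DLR state (the untruncated solutions are exactly the DLR expectation
functionals). [folklore] -/
theorem bootstrap_convergence_dlr_suN (N : ℕ) (β : ℝ)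
    (V : ℕ → Set C(LGConfig d (Matrix.specialUnitaryGroup (Fin N) ℂ), ℝ))
    (hex : ∀ a ∈ polyAlgebra (ι := ZdEdge d) (fundamentalLatticeRep N), ∀ᶠ n in atTop, a ∈ V n)
    {P : C(LGConfig d (Matrix.specialUnitaryGroup (Fin N) ℂ), ℝ)}
    (hP : P ∈ polyAlgebra (ι := ZdEdge d) (fundamentalLatticeRep N)) {ε : ℝ} (hε : 0 < ε) :
    ∃ n, ∀ φ : C(LGConfig d (Matrix.specialUnitaryGroup (Fin N) ℂ), ℝ) →ₗ[ℝ] ℝ,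
      IsBootstrapFeasible (fundamentalLatticeRep N) (suExp N)
          (fun e => wilsonBoundaryAction (fundamentalRep (Fin N)) {e}) β (V n) φ →
        ∃ μ ∈ ymGibbsMeasures (d := d) (fundamentalRep (Fin N)) β, |φ P - ∫ U, P U ∂μ| ≤ ε := by
  obtain ⟨n, hn⟩ := bootstrap_convergence (fundamentalLatticeRep N) (suExp_add N)
    (X := fun X : SuGenerator N => (X : Matrix (Fin N) (Fin N) ℂ)) (rho_suExp N)
    (fun e => wilsonBoundaryAction_mem_polyFunctions (fundamentalLatticeRep N) {e}) V hex hP hε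
  refine ⟨n, fun φ hφ => ?_⟩
  obtain ⟨ψ, hψ, hclose⟩ := hn φ hφ
  obtain ⟨μ, hμ, hψμ⟩ := exists_dlr_of_bootstrap_suN N β hψ.1 hψ.2.1 hψ.2.2
  exact ⟨μ, hμ, by rwa [hψμ P hP] at hclose⟩

end Unitary

end Summit.QuantumFields.GaugeBoot

end
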